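import Summits.QuantumFields.BalabanUV.Beta.GAN24.CombWilsonStepPush
import Summits.QuantumFields.BalabanUV.Beta.GAN24.LegCompAssoc

/-!
# `BalabanUV.Beta.GAN24.CombLegChainGauge` — binder row G-an2-4 ∕ (CONV-C), TRANSFER-III (the (III′) column of RULING R-gan24p1-g46-2), THE COMB LEG DICTIONARY, FIRST WORD:
# **THE CONJUGATED (COMB-CHART) LEG CHAIN IS THE DRESSED (E) LEG CHAIN PLUS AN INTER-BLOCK PURE GAUGE — EXACTLY**:
# `legAct (legChain (j ↦ legComp ψ♭ R_j) m k) b = legAct (legChain R m k) b + dz (PsiFace r ρ Lc m k b)`, `R_j = respStepBmSeq ρ Lc j`, `ψ♭ α x κ u = Ψ̂_S u x (inl κ) (inl α)`,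
# `Ψ̂_S = psiKS r Lc` (OWNER of row G-an2-4, unit `b2b-balaban-gan24-p1` gen 47; INTENT-1 [GAN24P1-G47-INTENT-1] l.65977; no existing file touched)

NOT IN PRINT; OUR BOOKKEEPING ([folklore] `ℓ¹`-Fubini and finite-sum bookkeeping BY NAME over d1-formalise-leaf-03's `SymCorrectorForms.corrPsiS ∕ zetaS` (`zetaS_dz_ext`,
`depOn_zetaS`), `SymCorrectorKernel.psiKS` (`corrPsiS_apply_eq_sum`, `psiKS_inl_inl_eq_zero`), `SymCorrectorFace.faceWt ∕ faceWt_shift`; gan24-formalise-leaf-03's (E) leg calculus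
`RespStepBmDecompLegs ∕ Exact ∕ Psi` + `LegCompAssoc.legChain_succ_left`; road-P2's M.47 ∕ M.49 `legDecay_psiKS` ∕ `legDecay_legComp_psiKS`; leaf-01's `Push4Iter.legDecay_legChain`;
the literature cell's `AxialDressing.summable_blockMass`; TWO bookkeeping `def`s ([our objects] `facePotential`, `PsiFace` — the (III′) companions of leaf-03's
`RespStepBmDecompPsi.Psi`), 0 cited facts, 0 `def … : Prop`, 0 sorry).  HONEST FRAMING (cell contract, verbatim): «discharging `BetaPertH` makes Bałaban's UV stability
UNCONDITIONAL — a real constructive-QFT result; it is NOT the continuum limit and NOT the Clay problem.»  HONEST DEPENDENCY (verbatim): «continuum YM on T⁴ ⇐ BetaPertH ∧ nine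
spine estimates (0/9 proved); BetaPertH ⇐ (D1) ∧ (D4) ∧ CAP+tail; G-an2-4 gates asym, D1 and NE2/3/4.»

WHY (`gen46/ALPHA0-STATUS.md` v0.16 §1b: links L11–L13 and the leg-letter rows at (III′) «need the comb LEG dictionary first — NOBODY today»; road-P2 g55 MEMO M-3 §3(a)
«whether the face insertions telescope — FIRST TEST TO RUN»).  By an2's `CombChartTransportLevel.GcombSh_eq_conj_psiKS_KInvStep` the comb-chart resolvent is `Ψ̂_S ∘ G^{bm}_j ∘ Ψ̂_Sᵀ`,
and road-P2's M.47 ∕ M.49 show that every (III′) leg is the (E) dressed leg `R_j` FOLLOWED BY the field block `ψ♭` of `Ψ̂_S`, composite legs `legChain (j ↦ legComp ψ♭ R_j) m k`.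
THIS FILE: the leg action of `ψ♭` IS the corrector `Ψ_S = corrPsiS (toSite r) n`, i.e. `A ↦ A + dz (facePotential r n A)` with the BLOCK-CONSTANT potential
`facePotential r n A = |box n|⁻¹ • ext n (ζ_S A)`; a block-constant pure gauge is KILLED by `ζ_S` and TRANSPORTED by the dressed legs as a block-constant pure gauge with the
factor `(Lc^{d+1})⁻¹` per level; hence the face insertions telescope into the gauge part AS AN IDENTITY (§1 `legAct_psiLeg`, `corrPsiS_dz_ext`, `zetaS_eq_card_mul_sum_faceWt`,
`abs_facePotential_le` (mass) ∕ `_of_abs_le` (SUP currency), `summable_facePotential`; §2 `legAct_legComp_psiLeg`; §3 `PsiFace` (recursive at the FINE end, datum fixed),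
`legAct_legComp_psiLeg_respStepBm_dz` (the conjugated one-step leg has THE SAME exact-datum law as the dressed leg), `legAct_legChain_psiLeg_dz`, `summable_PsiFace`,
**`legAct_legChain_psiLeg_eq`** (THE DECOMPOSITION), `…_eq_axProjBmAt_add_dz` (`= Π^ρ_bm (legAct (respStep (Lc^m) (Lc^(m+k+1))) b) + dz (Psi … + PsiFace …)`), `curv_legAct_legChain_psiLeg`).
READING (zero weight): the (III′) LEG WORDS differ from the (E) ones ONLY by block-constant pure gauges created at the block faces of each level and transported rigidly; every
gauge-blind reading (curvature, co-closed contractions, `Π_bm`-windows) of the (III′) legs EQUALS the (E) one; the envelopes of the OWNER's parts 1 ∕ 2 (`DressedLegSawtoothBlockL1`,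
`DressedLegBlockL1Envelope`) transfer through ONE extra sawtooth term per level, read in SUP currency (`abs_facePotential_le_of_abs_le`) — the NEXT word, not this file.
WHAT THIS IS NOT: NOT an envelope ∕ estimate (no rate, no constant beyond existential plumbing), NOT the windows L11–L13, NOT a letter row at the comb data, NOT a value of Bałaban's
tables; the full-row (`kChain`) legs with multiplier columns are not treated (their field columns are these chains: OWNER part 4 `CarrierKernelLegBlockL1.kChain_inl_eq_legChain`); the (III′)
campaign is NOT asked (an2 W-4 l.64553) — typed while idle under R-2; NEVER «G-an2-4 closed» as (CONV-C); NOT D1, NOT `BetaPertH`, NOT continuum, NOT Clay.  2026-08-25.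
-/

noncomputable section

open Finset
open scoped BigOperators
open Literature.MathematicalPhysics.QuantumFieldTheory
open Literature.MathematicalPhysics.QuantumFieldTheory.Balaban1983to89
open Literature.MathematicalPhysics.QuantumFieldTheory.Balaban1983to89.Beta
open AffineAveraging (Form0 Form1 Site box toSite unitVec dz)
open AffineReproduction (dz_sub dz_add dz_const)
open AveragingContours (blk blk_block off off_mem_box blk_add_off)
open AxialProjector (toSite_injective)
open AxialDressing (blockMass summable_blockMass)
open BalabanCompositeJets (respStep)
open KKTFluctuationEnergy (summable_dz)
open Summit.QuantumFields.BalabanUV.Beta.AxialProjectorBlockMean (axProjBmAt)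
open Summit.QuantumFields.BalabanUV.Beta.CompositeCorrectorForms (ext)
open Summit.QuantumFields.BalabanUV.Beta.CompositeCorrectorLocality (InBlockBond mem_inBlockBond CorrReads)
open Summit.QuantumFields.BalabanUV.Beta.CompositeCorrectorKernel (indR indR_apply sum_smul_indR_apply)
open Summit.QuantumFields.BalabanUV.Beta.SymCorrectorForms (zetaS corrPsiS zetaS_add zetaS_smul zetaS_zero zetaS_dz_ext depOn_zetaS corrPsiS_smul)
open Summit.QuantumFields.BalabanUV.Beta.SymCorrectorKernel (psiKS psiKS_inl_inl psiKS_inl_inl_eq_zero exists_finset_corrReadsS corrPsiS_apply_eq_sum)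
open Summit.QuantumFields.BalabanUV.Beta.SymCorrectorFace (faceWt faceWtSum faceWtSum_nonneg abs_faceWt_le faceWt_shift)
open Summit.QuantumFields.BalabanUV.Beta.GAN24.Push4 (legComp)
open Summit.QuantumFields.BalabanUV.Beta.GAN24.Push4Bounds (LegDecay)
open Summit.QuantumFields.BalabanUV.Beta.GAN24.Push4Iter (LegFam legChain legChain_zero legChain_succ legDecay_legChain)
open Summit.QuantumFields.BalabanUV.Beta.GAN24.RespStepBm (respStepBm)
open Summit.QuantumFields.BalabanUV.Beta.GAN24.RespStepBmDecompLegs (legAct legAct_apply LegL1 legL1_of_legDecay summable_legAct legAct_sub legAct_smul legAct_legComp)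
open Summit.QuantumFields.BalabanUV.Beta.GAN24.RespStepBmDecompExact (respStepBmSeq respStepBmSeq_apply exists_legL1_respStepBmSeq
  exists_abs_legChain_le legAct_legChain_dz legAct_respStepBm_dz summable_comp_blk' blk_blk_pow)
open Summit.QuantumFields.BalabanUV.Beta.GAN24.RespStepBmDecompPsi (Psi dz_smul legAct_legChain_respStepBm)
open Summit.QuantumFields.BalabanUV.Beta.GAN24.CombWilsonStepPush (legDecay_legComp_psiKS)
open Summit.QuantumFields.BalabanUV.Beta.GAN24.LegCompAssoc (legChain_succ_left)

namespace Summit.QuantumFields.BalabanUV.Beta.GAN24.CombLegChainGauge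

variable {d : ℕ}

/-! ## §1 The leg action of `ψ♭` is the corrector `Ψ_S`; the face potential -/

/-- [our object] **THE FACE POTENTIAL OF A ONE-FORM** at blocking `n` (root offset `r`): `facePotential r n A := |box n|⁻¹ • ext n (ζ_S A)` — the
BLOCK-CONSTANT potential whose gradient the symmetrised corrector adds: `Ψ_S A = A + dz (facePotential r n A)` (`corrPsiS_eq_add_dz_facePotential`). -/
def facePotential (r : Fin (d + 1) → ℕ) (n : ℕ) (A : Form1 (d + 1) ℝ) : Form0 (d + 1) ℝ :=
  (((box (d + 1) n).card : ℝ)⁻¹) • ext n (zetaS (toSite r) n A)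

/-- [folklore] `facePotential`, pointwise: `facePotential r n A x = |box n|⁻¹ · ζ_S A (blk n x)`. -/
theorem facePotential_apply (r : Fin (d + 1) → ℕ) (n : ℕ) (A : Form1 (d + 1) ℝ) (x : Site (d + 1)) : facePotential r n A x = ((box (d + 1) n).card : ℝ)⁻¹ * zetaS (toSite r) n A (blk n x) := rfl

/-- [folklore] **`Ψ_S A = A + dz (facePotential A)`** — d1-formalise-leaf-03's `SymCorrectorForms.corrPsiS` read through `facePotential` (its definition, `dz` linear). -/
theorem corrPsiS_eq_add_dz_facePotential (r : Fin (d + 1) → ℕ) (n : ℕ) (A : Form1 (d + 1) ℝ) :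
    corrPsiS (toSite r) n A = A + dz (facePotential r n A) := by
  rw [facePotential, dz_smul]
  rfl

section PsiLeg

variable {n : ℕ} (hn : 0 < n) {r : Fin (d + 1) → ℕ} (hr : r ∈ box (d + 1) n)
include hn hr

omit hn in
/-- [folklore] **NILPOTENCY: THE FACE POTENTIAL OF A BLOCK-CONSTANT PURE GAUGE VANISHES** — `facePotential r n (dz (ext n g)) = 0`
(d1-formalise-leaf-03's `SymCorrectorForms.zetaS_dz_ext`: `ζ_S` kills `dz ∘ ext n`). -/
theorem facePotential_dz_ext (g : Form0 (d + 1) ℝ) : facePotential r n (dz (ext n g)) = 0 := by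
  funext x
  rw [facePotential_apply, zetaS_dz_ext hr]
  simp

omit hn in
/-- [folklore] **`Ψ_S` FIXES THE BLOCK-CONSTANT PURE GAUGES**: `Ψ_S (dz (ext n g)) = dz (ext n g)`. -/
theorem corrPsiS_dz_ext (g : Form0 (d + 1) ℝ) : corrPsiS (toSite r) n (dz (ext n g)) = dz (ext n g) := by
  have h0 : dz (0 : Form0 (d + 1) ℝ) = 0 := by funext κ x; simp [dz]
  rw [corrPsiS_eq_add_dz_facePotential, facePotential_dz_ext hr, h0, add_zero]

/-- [folklore] **THE LEG ACTION OF `ψ♭` IS `Ψ_S`** (EVERY one-form `A`, no summability: `Ψ̂_S` is row-finite — leaf-06's `apply_eq_sum_of_depOn` ∕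
d1-formalise-leaf-03's `corrPsiS_apply_eq_sum`, `psiKS_inl_inl_eq_zero`): with `ψ♭ α x κ u := Ψ̂_S u x (inl κ) (inl α)`,
`legAct ψ♭ A = Ψ_S A` — the `legAct` twin of leaf-06's `CompositeCorrectorKernel.comp_kerOf_inl`. -/
theorem legAct_psiLeg (A : Form1 (d + 1) ℝ) :
    legAct (fun α x κ u => psiKS r n u x (Sum.inl κ) (Sum.inl α)) A = corrPsiS (toSite r) n A := by
  classical
  funext κ u
  obtain ⟨S, hS⟩ := exists_finset_corrReadsS hn κ u
  have hST : ∀ p ∈ CorrReads n κ u, p ∈ Finset.univ ×ˢ S.image Prod.snd := fun p hp =>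
    Finset.mem_product.2 ⟨Finset.mem_univ _, Finset.mem_image_of_mem _ (hS p hp)⟩
  simp only [legAct_apply]
  rw [corrPsiS_apply_eq_sum hn hr κ u hST A, Finset.sum_product]
  refine Finset.sum_congr rfl fun μ _ => ?_
  rw [tsum_eq_sum (s := S.image Prod.snd) (fun y hy => ?_)]
  · exact Finset.sum_congr rfl fun y _ => by rw [psiKS_inl_inl, mul_comm]
  · rw [psiKS_inl_inl_eq_zero hn hr (fun hp => hy (Finset.mem_image_of_mem _ (hS _ hp))), mul_zero]

/-- [folklore] **THE FINITE EXPANSION OF `ζ_S` OVER THE BLOCK** (`depOn_zetaS`: `ζ_S A (Y)` reads only the bonds based in the block `Y`; the weights are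
the face weights of d1-formalise-leaf-03's `SymCorrectorFace`): `ζ_S A (Y) = |box n| · Σ_α Σ_{b ∈ box n} faceWt r n α (n•Y + b) · A α (n•Y + b)`. -/
theorem zetaS_eq_card_mul_sum_faceWt (A : Form1 (d + 1) ℝ) (Y : Site (d + 1)) :
    zetaS (toSite r) n A Y = ((box (d + 1) n).card : ℝ) *
      ∑ α : Fin (d + 1), ∑ b ∈ box (d + 1) n, faceWt r n α ((n : ℤ) • Y + toSite b) * A α ((n : ℤ) • Y + toSite b) := by
  classical
  set T : Finset (Site (d + 1)) := (box (d + 1) n).image fun b => (n : ℤ) • Y + toSite b with hT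
  set S : Finset (Fin (d + 1) × Site (d + 1)) := Finset.univ ×ˢ T with hSdef
  have hcard : ((box (d + 1) n).card : ℝ) ≠ 0 := by
    have : 0 < (box (d + 1) n).card := Finset.card_pos.2 ⟨off n 0, off_mem_box hn 0⟩
    exact_mod_cast this.ne'
  -- (1) `A` and its restriction to `S` agree on the in-block bonds
  have e1 : zetaS (toSite r) n A Y = zetaS (toSite r) n (∑ p ∈ S, A p.1 p.2 • indR p.1 p.2) Y := by
    apply (depOn_zetaS (d := d + 1) hn hr Y).eq
    intro κ y hp
    have hy : blk n y = Y := (mem_inBlockBond.1 hp).1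
    rw [sum_smul_indR_apply, if_pos]
    refine Finset.mem_product.2 ⟨Finset.mem_univ _, Finset.mem_image.2 ⟨off n y, off_mem_box hn y, ?_⟩⟩
    rw [← hy, blk_add_off hn]
  -- (2) linearity of `ζ_S` over the finite combination
  have e2 : ∀ s : Finset (Fin (d + 1) × Site (d + 1)),
      zetaS (toSite r) n (∑ p ∈ s, A p.1 p.2 • indR p.1 p.2) Y = ∑ p ∈ s, A p.1 p.2 * zetaS (toSite r) n (indR p.1 p.2) Y := by
    intro s
    induction s using Finset.induction_on with
    | empty => rw [Finset.sum_empty, Finset.sum_empty, zetaS_zero]; rfl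
    | insert p s hp ih => rw [Finset.sum_insert hp, Finset.sum_insert hp, zetaS_add, Pi.add_apply, ih, zetaS_smul, Pi.smul_apply, smul_eq_mul]
  -- (3) the indicator values are the face weights
  have e3 : ∀ (α : Fin (d + 1)) (b : Fin (d + 1) → ℕ), b ∈ box (d + 1) n →
      zetaS (toSite r) n (indR α ((n : ℤ) • Y + toSite b)) Y = ((box (d + 1) n).card : ℝ) * faceWt r n α ((n : ℤ) • Y + toSite b) := by
    intro α b hb
    rw [faceWt, blk_block Y hb, ← mul_assoc, mul_inv_cancel₀ hcard, one_mul]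
  have hinj : Set.InjOn (fun b : Fin (d + 1) → ℕ => (n : ℤ) • Y + toSite b) (box (d + 1) n : Set (Fin (d + 1) → ℕ)) :=
    fun b₁ _ b₂ _ h => toSite_injective (add_left_cancel h)
  rw [e1, e2, hSdef, Finset.sum_product, Finset.mul_sum]
  refine Finset.sum_congr rfl fun α _ => ?_
  rw [hT, Finset.sum_image hinj, Finset.mul_sum]
  exact Finset.sum_congr rfl fun b hb => by rw [e3 α b hb]; ring

/-- [folklore] **THE FACE POTENTIAL IS A FINITE WEIGHTED BLOCK SUM**: `facePotential r n A x = Σ_α Σ_{b ∈ box n} faceWt r n α (n•blk x + b) · A α (n•blk x + b)`. -/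
theorem facePotential_eq_sum_faceWt (A : Form1 (d + 1) ℝ) (x : Site (d + 1)) :
    facePotential r n A x = ∑ α : Fin (d + 1), ∑ b ∈ box (d + 1) n,
      faceWt r n α ((n : ℤ) • blk n x + toSite b) * A α ((n : ℤ) • blk n x + toSite b) := by
  have hcard : ((box (d + 1) n).card : ℝ) ≠ 0 := by
    have : 0 < (box (d + 1) n).card := Finset.card_pos.2 ⟨off n 0, off_mem_box hn 0⟩
    exact_mod_cast this.ne'
  rw [facePotential_apply, zetaS_eq_card_mul_sum_faceWt hn hr, ← mul_assoc, inv_mul_cancel₀ hcard, one_mul]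

/-- [folklore] **THE FACE POTENTIAL IS BOUNDED BY THE BLOCK MASS**: `|facePotential r n A x| ≤ faceWtSum r n · blockMass n A (blk n x)` (`abs_faceWt_le`). -/
theorem abs_facePotential_le (A : Form1 (d + 1) ℝ) (x : Site (d + 1)) :
    |facePotential r n A x| ≤ faceWtSum r n * blockMass n A (blk n x) := by
  rw [facePotential_eq_sum_faceWt hn hr, blockMass, Finset.mul_sum, Finset.sum_comm]
  refine (Finset.abs_sum_le_sum_abs _ _).trans (Finset.sum_le_sum fun b _ => ?_)
  rw [Finset.mul_sum]
  refine (Finset.abs_sum_le_sum_abs _ _).trans (Finset.sum_le_sum fun α _ => ?_)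
  rw [abs_mul]
  exact mul_le_mul (abs_faceWt_le hn r α _) le_rfl (abs_nonneg _) (faceWtSum_nonneg r n)

/-- [folklore] **THE FACE POTENTIAL IN SUP CURRENCY** (the envelope reading): if `|A α y| ≤ M` on the block of `x`, then `|facePotential r n A x| ≤ faceWtSum r n · M` —
by block covariance (`faceWt_shift`) the weights over ANY block sum to exactly `faceWtSum r n` (a `Lc`-free table at the root block), so the face potential
costs the SUP of the field on the block, NOT its mass. -/
theorem abs_facePotential_le_of_abs_le (A : Form1 (d + 1) ℝ) (x : Site (d + 1)) {M : ℝ}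
    (hM : ∀ (α : Fin (d + 1)) (b : Fin (d + 1) → ℕ), b ∈ box (d + 1) n → |A α ((n : ℤ) • blk n x + toSite b)| ≤ M) :
    |facePotential r n A x| ≤ faceWtSum r n * M := by
  rw [facePotential_eq_sum_faceWt hn hr, faceWtSum, Finset.sum_mul]
  refine (Finset.abs_sum_le_sum_abs _ _).trans (Finset.sum_le_sum fun α _ => ?_)
  rw [Finset.sum_mul]
  refine (Finset.abs_sum_le_sum_abs _ _).trans (Finset.sum_le_sum fun b hb => ?_)
  rw [abs_mul, add_comm, faceWt_shift hn]
  exact mul_le_mul_of_nonneg_left (by rw [add_comm]; exact hM α b hb) (abs_nonneg _)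

/-- [folklore] **A COMPONENTWISE-SUMMABLE ONE-FORM HAS A SUMMABLE FACE POTENTIAL** (`AxialDressing.summable_blockMass`, read through the block label). -/
theorem summable_facePotential {A : Form1 (d + 1) ℝ} (hA : ∀ κ, Summable (A κ)) : Summable (facePotential r n A) := by
  haveI : NeZero n := ⟨hn.ne'⟩
  have h1 : Summable fun Y : Site (d + 1) => faceWtSum r n * blockMass n A Y := (summable_blockMass hA).mul_left _
  have h2 : Summable fun x : Site (d + 1) => faceWtSum r n * blockMass n A (blk n x) :=
    summable_comp_blk' (ψ := fun Y => faceWtSum r n * blockMass n A Y) hn h1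
  refine Summable.of_norm_bounded h2 fun x => ?_
  rw [Real.norm_eq_abs]
  exact abs_facePotential_le hn hr A x

/-! ## §2 One conjugated leg `ψ♭ ∘ R` acts as `Ψ_S ∘ R` -/

/-- [folklore] `ψ♭` is a bounded leg family (road-P2's M.47 `CombTransportPush.legDecay_psiKS` at rate `0`, via M.49). -/
theorem exists_abs_psiLeg_le : ∃ C : ℝ, ∀ α x κ u, |psiKS r n u x (Sum.inl κ) (Sum.inl α)| ≤ C := by
  obtain ⟨C, hC⟩ := CombTransportPush.legDecay_psiKS (d := d) hn hr (m := 0) le_rfl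
  exact ⟨C, fun α x κ u => hC.abs_le le_rfl α x κ u⟩

/-- [folklore] **ONE CONJUGATED LEG ACTS AS `Ψ_S` AFTER THE LEG** (summable datum, `R ∈ LegL1`; leaf-03's Fubini `legAct_legComp` + §1):
`legAct (legComp ψ♭ R) b = Ψ_S (legAct R b)`. -/
theorem legAct_legComp_psiLeg {b : Form1 (d + 1) ℝ} (hb : ∀ μ, Summable (b μ)) {R : LegFam d} {C T : ℝ} (hR : LegL1 R C T) :
    legAct (legComp (fun α x κ u => psiKS r n u x (Sum.inl κ) (Sum.inl α)) R) b = corrPsiS (toSite r) n (legAct R b) := by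
  obtain ⟨Cψ, hψ⟩ := exists_abs_psiLeg_le hn hr
  rw [legAct_legComp hb hR hψ, legAct_psiLeg hn hr]

/-- [folklore] **… DISPLAYED**: `legAct (legComp ψ♭ R) b = legAct R b + dz (facePotential r n (legAct R b))` — the conjugated leg is the leg PLUS THE GRADIENT
OF THE (block-constant) FACE POTENTIAL OF ITS OUTPUT. -/
theorem legAct_legComp_psiLeg_eq_add_dz {b : Form1 (d + 1) ℝ} (hb : ∀ μ, Summable (b μ)) {R : LegFam d} {C T : ℝ} (hR : LegL1 R C T) :
    legAct (legComp (fun α x κ u => psiKS r n u x (Sum.inl κ) (Sum.inl α)) R) b = legAct R b + dz (facePotential r n (legAct R b)) := by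
  rw [legAct_legComp_psiLeg hn hr hb hR, corrPsiS_eq_add_dz_facePotential]

end PsiLeg

/-! ## §3 The conjugated dressed leg chains of the (III′) recursion (`n = Lc`): exact data, the face term `PsiFace`, the decomposition -/

section Dressed

variable {Lc : ℕ} [NeZero Lc]

/-- [our object] **THE ACCUMULATED FACE POTENTIAL `Ψ^face_{m, m+k+1}` OF THE CONJUGATED CHAIN** acting on the datum `b` (root offset `r` of `Ψ̂_S`, root `ρ` of the
dressing; recursive in the length AT THE FINE END, the datum FIXED — the (III′) companion of leaf-03's `RespStepBmDecompPsi.Psi`): the face potential of the full (E) chain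
output `legAct (legChain R m k) b` at the bottom level PLUS the face term of the upper chain (levels `m+1 … m+k`) transported ONE level down — read through the block label
`blk Lc` with the factor `(Lc^{d+1})⁻¹`; unrolled, `Σ_{i ≤ k} (Lc^{(d+1) i})⁻¹ · facePotential (legAct (legChain R (m+i) (k−i)) b) ∘ blk (Lc^i)` (`R = respStepBmSeq ρ Lc`). -/
def PsiFace (r : Fin (d + 1) → ℕ) (ρ : Fin (d + 1) → ℤ) (Lc : ℕ) [NeZero Lc] : ℕ → ℕ → Form1 (d + 1) ℝ → Form0 (d + 1) ℝ
  | m, 0, b => facePotential r Lc (legAct (respStepBmSeq (d := d) ρ Lc m) b)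
  | m, k + 1, b => facePotential r Lc (legAct (legChain (respStepBmSeq (d := d) ρ Lc) m (k + 1)) b)
      + (((Lc : ℝ) ^ (d + 1))⁻¹) • fun x => PsiFace r ρ Lc (m + 1) k b (blk Lc x)

/-- [folklore] `PsiFace`, length `0`. -/
theorem PsiFace_zero (r : Fin (d + 1) → ℕ) (ρ : Fin (d + 1) → ℤ) (m : ℕ) (b : Form1 (d + 1) ℝ) : PsiFace r ρ Lc m 0 b = facePotential r Lc (legAct (respStepBmSeq (d := d) ρ Lc m) b) := rfl

/-- [folklore] `PsiFace`, the recursion at the fine end. -/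
theorem PsiFace_succ (r : Fin (d + 1) → ℕ) (ρ : Fin (d + 1) → ℤ) (m k : ℕ) (b : Form1 (d + 1) ℝ) :
    PsiFace r ρ Lc m (k + 1) b = facePotential r Lc (legAct (legChain (respStepBmSeq (d := d) ρ Lc) m (k + 1)) b)
      + (((Lc : ℝ) ^ (d + 1))⁻¹) • fun x => PsiFace r ρ Lc (m + 1) k b (blk Lc x) := rfl

variable {r : Fin (d + 1) → ℕ} (hr : r ∈ box (d + 1) Lc) {rr : Fin (d + 1) → ℕ} (hrr : rr ∈ box (d + 1) Lc)
include hr hrr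

omit hrr in
/-- [folklore] **THE CONJUGATED DRESSED ONE-STEP LEG HAS THE SAME EXACT-DATUM LAW AS THE DRESSED LEG**:
`legAct (legComp ψ♭ (respStepBm ρ Lc (Lc^m) (Lc^(m+1)))) (dz ψ) = (Lc^{d+1})⁻¹ • dz (ψ ∘ blk Lc)` — the dressed leg turns a coarse pure gauge into a
BLOCK-CONSTANT pure gauge (leaf-03's `legAct_respStepBm_dz` over gan24-p4's gauge law), which `Ψ_S` FIXES (§1 `corrPsiS_dz_ext`). -/
theorem legAct_legComp_psiLeg_respStepBm_dz {ρr : Fin (d + 1) → ℕ} (hρr : ρr ∈ box (d + 1) Lc) (m : ℕ) {ψ : Form0 (d + 1) ℝ} (hψ : Summable ψ) :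
    legAct (legComp (fun α x κ u => psiKS r Lc u x (Sum.inl κ) (Sum.inl α)) (respStepBm (toSite ρr) Lc (Lc ^ m) (Lc ^ (m + 1)))) (dz ψ)
      = (((Lc : ℝ) ^ (d + 1))⁻¹) • dz (fun x => ψ (blk Lc x)) := by
  have hLc : 0 < Lc := Nat.pos_of_ne_zero (NeZero.ne Lc)
  obtain ⟨C, T, hR⟩ := exists_legL1_respStepBmSeq (d := d) hρr m
  rw [respStepBmSeq_apply] at hR
  rw [legAct_legComp_psiLeg hLc hr (fun μ => summable_dz hψ μ) hR, legAct_respStepBm_dz hρr m hψ, corrPsiS_smul,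
    show (fun x => ψ (blk Lc x)) = ext Lc ψ from rfl, corrPsiS_dz_ext hr]

/-- [folklore] The conjugated dressed legs `ψ♭ ∘ R_j` are levelwise localised at blocking `Lc` (road-P2's M.49 `legDecay_legComp_psiKS`). -/
theorem legDecay_legComp_psiLeg (j : ℕ) :
    ∃ C m : ℝ, 0 < m ∧ LegDecay (legComp (fun α x κ u => psiKS r Lc u x (Sum.inl κ) (Sum.inl α)) (respStepBmSeq (d := d) (toSite rr) Lc j)) Lc C m :=
  legDecay_legComp_psiKS (d := d) (Nat.pos_of_ne_zero (NeZero.ne Lc)) hr (SrecWilsonSector.legDecay_respStepBmSeq hrr j)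

omit hr in
/-- [folklore] Every (E) chain is in the class `LegL1` (leaf-01's `legDecay_legChain`; constants existential). -/
theorem exists_legL1_legChain (m k : ℕ) : ∃ C T : ℝ, LegL1 (legChain (respStepBmSeq (d := d) (toSite rr) Lc) m k) C T := by
  obtain ⟨C, m', hm', h⟩ := legDecay_legChain (fun j => SrecWilsonSector.legDecay_respStepBmSeq (d := d) hrr j) m k
  exact ⟨_, _, legL1_of_legDecay h hm'⟩

/-- [folklore] Every conjugated chain is in the class `LegL1` (hence bounded). -/
theorem exists_legL1_legChain_psiLeg (m k : ℕ) :
    ∃ C T : ℝ, LegL1 (legChain (fun j => legComp (fun α x κ u => psiKS r Lc u x (Sum.inl κ) (Sum.inl α)) (respStepBmSeq (d := d) (toSite rr) Lc j)) m k) C T := by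
  obtain ⟨C, m', hm', h⟩ := legDecay_legChain
    (l := fun j => legComp (fun α x κ u => psiKS r Lc u x (Sum.inl κ) (Sum.inl α)) (respStepBmSeq (d := d) (toSite rr) Lc j))
    (fun j => legDecay_legComp_psiLeg (d := d) hr hrr j) m k
  exact ⟨_, _, legL1_of_legDecay h hm'⟩

/-- [folklore] **EXACT DATA THROUGH THE CONJUGATED CHAIN — AS AT (E)** (every `m`, every length `k`, summable `ψ`):
`legAct (legChain (j ↦ legComp ψ♭ R_j) m k) (dz ψ) = (Lc^{(d+1)(k+1)})⁻¹ • dz (ψ ∘ blk (Lc^(k+1)))` — leaf-03's `RespStepBmDecompExact.legAct_legChain_dz`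
VERBATIM for the conjugated legs (each `Ψ_S` fixes the transported block-constant gauge). -/
theorem legAct_legChain_psiLeg_dz (m : ℕ) :
    ∀ (k : ℕ) {ψ : Form0 (d + 1) ℝ}, Summable ψ →
      legAct (legChain (fun j => legComp (fun α x κ u => psiKS r Lc u x (Sum.inl κ) (Sum.inl α)) (respStepBmSeq (d := d) (toSite rr) Lc j)) m k) (dz ψ)
        = (((Lc : ℝ) ^ ((d + 1) * (k + 1)))⁻¹) • dz (fun x => ψ (blk (Lc ^ (k + 1)) x))
  | 0, ψ, hψ => by
    rw [legChain_zero, respStepBmSeq_apply, legAct_legComp_psiLeg_respStepBm_dz hr hrr m hψ]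
    simp only [Nat.zero_add, Nat.mul_one, pow_one]
  | k + 1, ψ, hψ => by
    have hLc : 1 ≤ Lc := Nat.one_le_iff_ne_zero.2 (NeZero.ne Lc)
    obtain ⟨C₁, m₁, hm₁, h₁⟩ := legDecay_legComp_psiLeg (d := d) hr hrr (m + k + 1)
    obtain ⟨C₂, T₂, h₂⟩ := exists_legL1_legChain_psiLeg (d := d) hr hrr m k
    rw [legChain_succ, legAct_legComp (fun μ => summable_dz hψ μ) (legL1_of_legDecay h₁ hm₁) h₂.abs_le, respStepBmSeq_apply,
      legAct_legComp_psiLeg_respStepBm_dz hr hrr (m + k + 1) hψ, legAct_smul,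
      legAct_legChain_psiLeg_dz m k (summable_comp_blk' hLc hψ), smul_smul]
    congr 1
    · rw [← mul_inv, ← pow_add]; congr 2; ring
    · congr 1; funext x; rw [blk_blk_pow]

/-- [folklore] **THE FACE TERM OF A SUMMABLE DATUM IS SUMMABLE** (every `m k`; §1 `summable_facePotential` through the chain's `ℓ¹ → ℓ¹` action, one block label per level). -/
theorem summable_PsiFace (k : ℕ) : ∀ (m : ℕ) {b : Form1 (d + 1) ℝ}, (∀ μ, Summable (b μ)) → Summable (PsiFace r (toSite rr) Lc m k b) := by
  have hLc : 0 < Lc := Nat.pos_of_ne_zero (NeZero.ne Lc)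
  induction k with
  | zero =>
    intro m b hb
    obtain ⟨C, T, hR⟩ := exists_legL1_respStepBmSeq (d := d) hrr m
    rw [PsiFace_zero]
    exact summable_facePotential hLc hr fun κ => summable_legAct hb hR κ
  | succ k ih =>
    intro m b hb
    obtain ⟨C, T, hR⟩ := exists_legL1_legChain (d := d) hrr m (k + 1)
    have h1 : Summable (facePotential r Lc (legAct (legChain (respStepBmSeq (d := d) (toSite rr) Lc) m (k + 1)) b)) :=
      summable_facePotential hLc hr fun κ => summable_legAct hb hR κ
    have h2 : Summable fun x => ((Lc : ℝ) ^ (d + 1))⁻¹ * PsiFace r (toSite rr) Lc (m + 1) k b (blk Lc x) :=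
      (summable_comp_blk' hLc (ih (m + 1) hb)).mul_left _
    have e : PsiFace r (toSite rr) Lc m (k + 1) b
        = fun x => facePotential r Lc (legAct (legChain (respStepBmSeq (d := d) (toSite rr) Lc) m (k + 1)) b) x
          + ((Lc : ℝ) ^ (d + 1))⁻¹ * PsiFace r (toSite rr) Lc (m + 1) k b (blk Lc x) := by
      rw [PsiFace_succ]; rfl
    rw [e]
    exact h1.add h2

/-- [folklore] **THE DECOMPOSITION OF THE CONJUGATED (COMB-CHART) LEG CHAIN**: for every length `k`, every `m` and every componentwise-summable datum `b`,
`legAct (legChain (j ↦ legComp ψ♭ R_j) m k) b = legAct (legChain R m k) b + dz (PsiFace r ρ Lc m k b)`, `R = respStepBmSeq ρ Lc` —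
THE (III′) COMPOSITE LEG IS THE (E) COMPOSITE LEG PLUS AN INTER-BLOCK PURE GAUGE.  Induction on `k` at the FINE end (leaf-03's `LegCompAssoc.legChain_succ_left` for
both chains): the upper conjugated chain acts as the upper (E) chain plus `dz (PsiFace (m+1) k b)` (induction hypothesis); the bottom conjugated leg `ψ♭ ∘ R_m` sends the
first to `Ψ_S` of the full (E) output (§2) and the second to the block-constant gauge one level down (`legAct_legComp_psiLeg_respStepBm_dz`); `PsiFace_succ` collects. -/
theorem legAct_legChain_psiLeg_eq :
    ∀ (k m : ℕ) {b : Form1 (d + 1) ℝ}, (∀ μ, Summable (b μ)) →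
      legAct (legChain (fun j => legComp (fun α x κ u => psiKS r Lc u x (Sum.inl κ) (Sum.inl α)) (respStepBmSeq (d := d) (toSite rr) Lc j)) m k) b
        = legAct (legChain (respStepBmSeq (d := d) (toSite rr) Lc) m k) b + dz (PsiFace r (toSite rr) Lc m k b)
  | 0, m, b, hb => by
    have hLc : 0 < Lc := Nat.pos_of_ne_zero (NeZero.ne Lc)
    obtain ⟨C, T, hR⟩ := exists_legL1_respStepBmSeq (d := d) hrr m
    rw [legChain_zero, legChain_zero, legAct_legComp_psiLeg_eq_add_dz hLc hr hb hR, PsiFace_zero]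
  | k + 1, m, b, hb => by
    have hLc : 0 < Lc := Nat.pos_of_ne_zero (NeZero.ne Lc)
    have hLc1 : 1 ≤ Lc := hLc
    -- the two fine-end recursions
    have eC := legChain_succ_left hLc1 (legDecay_legComp_psiLeg (d := d) hr hrr) m k
    have eE := legChain_succ_left hLc1 (fun j => SrecWilsonSector.legDecay_respStepBmSeq (d := d) hrr j) m k
    -- constants
    obtain ⟨C₀, T₀, h₀⟩ := exists_legL1_respStepBmSeq (d := d) hrr m                    -- `R_m ∈ LegL1`
    obtain ⟨Cψ, mψ, hmψ, hψ⟩ := legDecay_legComp_psiLeg (d := d) hr hrr m              -- `ψ♭ ∘ R_m` localised, hence bounded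
    obtain ⟨C₁, T₁, h₁⟩ := exists_legL1_legChain (d := d) hrr (m + 1) k                -- the upper (E) chain
    obtain ⟨C₁', T₁', h₁'⟩ := exists_legL1_legChain_psiLeg (d := d) hr hrr (m + 1) k   -- the upper conjugated chain
    -- the upper (E) output `X` and the upper face term `Φ`, both summable
    set X : Form1 (d + 1) ℝ := legAct (legChain (respStepBmSeq (d := d) (toSite rr) Lc) (m + 1) k) b with hX_def
    have hX : ∀ μ, Summable (X μ) := fun μ => summable_legAct hb h₁ μ
    have hΦ : Summable (PsiFace r (toSite rr) Lc (m + 1) k b) := summable_PsiFace hr hrr k (m + 1) hb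
    have hdzΦ : ∀ μ, Summable (dz (PsiFace r (toSite rr) Lc (m + 1) k b) μ) := fun μ => summable_dz hΦ μ
    -- the bottom conjugated leg is additive on the summable pair `(X, dz Φ)`
    have hsplit : legAct (legComp (fun α x κ u => psiKS r Lc u x (Sum.inl κ) (Sum.inl α)) (respStepBmSeq (d := d) (toSite rr) Lc m))
          (X + dz (PsiFace r (toSite rr) Lc (m + 1) k b))
        = legAct (legComp (fun α x κ u => psiKS r Lc u x (Sum.inl κ) (Sum.inl α)) (respStepBmSeq (d := d) (toSite rr) Lc m)) X
          + legAct (legComp (fun α x κ u => psiKS r Lc u x (Sum.inl κ) (Sum.inl α)) (respStepBmSeq (d := d) (toSite rr) Lc m))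
              (dz (PsiFace r (toSite rr) Lc (m + 1) k b)) := by
      have h := legAct_sub (b₁ := X + dz (PsiFace r (toSite rr) Lc (m + 1) k b)) (b₂ := dz (PsiFace r (toSite rr) Lc (m + 1) k b))
        (fun μ => (hX μ).add (hdzΦ μ)) hdzΦ (hψ.abs_le hmψ.le)
      rw [add_sub_cancel_right] at h
      rw [h, sub_add_cancel]
    rw [eC, eE, legAct_legComp hb h₁' (hψ.abs_le hmψ.le), legAct_legComp hb h₁ h₀.abs_le, legAct_legChain_psiLeg_eq k (m + 1) hb, hsplit,
      legAct_legComp_psiLeg_eq_add_dz hLc hr hX h₀, respStepBmSeq_apply, legAct_legComp_psiLeg_respStepBm_dz hr hrr m hΦ, PsiFace_succ,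
      dz_add, dz_smul, add_assoc]
    -- the full (E) output at the bottom, read back through the fine-end recursion inside `PsiFace_succ`
    rw [eE, legAct_legComp hb h₁ h₀.abs_le, ← respStepBmSeq_apply]

/-- [folklore] **THE SAME, WITH leaf-03's (E) DECOMPOSITION PLUGGED IN** (`RespStepBmDecompPsi.legAct_legChain_respStepBm`): the conjugated composite leg acting on
`b` is `Π^ρ_bm` of an2's UNDRESSED composite response plus ONE gradient — the (E) inter-block gauge term `Psi` plus the face term `PsiFace`. -/
theorem legAct_legChain_psiLeg_eq_axProjBmAt_add_dz (m k : ℕ) {b : Form1 (d + 1) ℝ} (hb : ∀ μ, Summable (b μ)) :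
    legAct (legChain (fun j => legComp (fun α x κ u => psiKS r Lc u x (Sum.inl κ) (Sum.inl α)) (respStepBmSeq (d := d) (toSite rr) Lc j)) m k) b
      = axProjBmAt (toSite rr) Lc (legAct (respStep (d := d) (Lc ^ m) (Lc ^ (m + k + 1))) b)
        + dz (Psi (toSite rr) Lc m k b + PsiFace r (toSite rr) Lc m k b) := by
  rw [legAct_legChain_psiLeg_eq hr hrr k m hb, legAct_legChain_respStepBm hrr m k hb, dz_add, add_assoc]

/-- [folklore] **THE CONJUGATED COMPOSITE LEG HAS THE CURVATURE OF an2's UNDRESSED COMPOSITE RESPONSE** — hence the same Maxwell operator `d*d`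
(leaf-03's `curv_legAct_legChain_respStepBm` for the (E) part; `curv ∘ dz = 0` for the face term): every gauge-blind reading of the (III′) legs is the (E) one. -/
theorem curv_legAct_legChain_psiLeg (m k : ℕ) {b : Form1 (d + 1) ℝ} (hb : ∀ μ, Summable (b μ)) :
    AffineAveraging.curv (legAct (legChain (fun j => legComp (fun α x κ u => psiKS r Lc u x (Sum.inl κ) (Sum.inl α))
        (respStepBmSeq (d := d) (toSite rr) Lc j)) m k) b)
      = AffineAveraging.curv (legAct (respStep (d := d) (Lc ^ m) (Lc ^ (m + k + 1))) b) := by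
  have e : ∀ (X : Form1 (d + 1) ℝ) (g : Form0 (d + 1) ℝ), X + dz g = X - dz ((-1 : ℝ) • g) := fun X g => by rw [dz_smul, neg_one_smul, sub_neg_eq_add]
  rw [legAct_legChain_psiLeg_eq hr hrr k m hb, e, RespStepBmDecompPsi.curv_sub_dz,
    RespStepBmDecompPsi.curv_legAct_legChain_respStepBm hrr m k hb]

end Dressed

end Summit.QuantumFields.BalabanUV.Beta.GAN24.CombLegChainGauge

end
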